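import Mathlib
import Summits.NavierStokesRegularity.NavierStokesRegularity.Theorems.TaoLadderRungTwoBreakBlowupRigidityOneEternalCompactness
import Summits.NavierStokesRegularity.NavierStokesRegularity.Theorems.TaoLadderRungTwoBreakBlowupRigidityOnePeriodicCompanion
import HarnessLib

/-!
# RIGIDITY = CONVERGENCE: an ASYMPTOTICALLY SHIFT-PERIODIC bounded admissible eternal solution with a front floor
  has an exactly shift-periodic ω-limit, hence its table carries a non-trivial (S₁)-surviving admissible DSS
  wave — the classification stub `stub_eternalIsDSS` of K2(1) `TaoLadderRungTwoBreak.BlowupRigidityOne`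
  (stmt-NavierStokesRegularity-20206) REDUCED TO ASYMPTOTIC PERIODICITY ALONG THE FRONT

MODEL lattice ODEs only (Tao 2016 §4 (4.8) in the self-similar variables of §6.4; cell vocabulary); nothing here
is a statement about the Navier–Stokes equations; NO item is closed (`--supports stmt-NavierStokesRegularity-20206`).
Route-independent (general `m`; `m = 4` in the stub-shaped corollary); DEF-FREE. Built on `…EternalCompactness`
(p819609: ω-limits of translates are admissible under a two-sided envelope) and `…PeriodicCompanion` (p819377:
shift-periodic admissible eternal solutions are DSS waves).

* `inv_le_dssMu_of_envelope` — a two-sided envelope `e^{2σ}‖W_n(σ)‖² ≤ Cₑ (e^{2T})^n` plus forward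
  (S₁)-survival force the lower survival half `(1+ε₀)⁻¹ ≤ μ = e^{2T}/(1+ε₀)^5`;
* `shiftPeriodic_limit_of_asymptoticallyPeriodic` — along the front-following centres `(jq, jqT)` the ω-limit
  of an asymptotically `(q,T)`-periodic solution (`W_{n+q+jq}(σ+qT+jqT) - W_{n+jq}(σ+jqT) → 0` pointwise) is
  EXACTLY shift-periodic, admissible, uniformly bounded, and keeps the front floor `δ ≤ ‖W∞_0(0)‖`;
* `survivingDSSWave_of_asymptoticallyPeriodic` — **THE CRUX'S CONCLUSION from asymptotic periodicity**: a
  uniformly bounded admissible eternal solution with envelope ratio `e^{2T}` (`T > 0`, `μ < 1`), a floor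
  `δ > 0` along the front `(jq, jqT)`, asymptotic `(q,T)`-periodicity and forward (S₁)-survival yields a
  non-trivial (S₁)-surviving admissible DSS wave of the same table;
* `stub_eternalIsDSS_of_asymptoticPeriodicity` — the REGISTERED STUB SIGNATURE of `stub_eternalIsDSS`
  (skeleton `9d85f4d387c689cd`) VERBATIM from: below a threshold, every `E₂(R)` table carrying a
  forward-surviving admissible eternal solution carries one that is uniformly bounded, enveloped, floored
  along a front and ASYMPTOTICALLY shift-periodic («surviving eternal solutions converge to DSS»).

HONEST LABEL: the asymptotic-periodicity property is the OPEN content (rigidity of the renormalised dynamics;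
chaotic / multi-bump attractors are printed for shell models, arXiv:2501.07377 p.20, arXiv:1201.1631);
nothing is proved about it; `stub_eternalFromBlowup` untouched; no stub, crux or summit is proved; rung 0.
-/

noncomputable section

-- the summit and its single sub-problem share the name (CONVENTIONS §1)
set_option linter.dupNamespace false

open Set Filter Topology MeasureTheory

namespace Summit.NavierStokesRegularity.NavierStokesRegularity.Theorems

namespace BlowupRigidityOne

open Literature.Analysis.FluidPDE Literature.Analysis.FluidPDE.TaoCascade

variable {m : ℕ}

/-- **Envelope + survival ⇒ the lower survival half.** If `e^{2σ}‖W_n(σ)‖² ≤ Cₑ (e^{2T})^n` for all shells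
and log-times and `W` is forward (S₁)-surviving, then `(1+ε₀)⁻¹ ≤ μ = e^{2T}/(1+ε₀)^5` (else the
`a = 1`-weighted energies `((1+ε₀)μ)^n Cₑ → 0` could not stay above a level).
[cite: Tao2016AveragedNS, §4 Lemma 4.1 (4.8)–(4.10) in self-similar variables, §6.4; cell vocabulary (`EternalSurvivingFwd`, `dssMu`)] -/
theorem inv_le_dssMu_of_envelope {ε₀ T Cₑ : ℝ} (hε : 0 < ε₀) {W : ℤ → ℝ → Em m}
    (henv : ∀ (n : ℤ) (σ : ℝ), Real.exp (2 * σ) * ‖W n σ‖ ^ 2 ≤ Cₑ * Real.exp (2 * T) ^ n)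
    (hS : EternalSurvivingFwd 1 ε₀ W) : (1 + ε₀) ^ (-(1 : ℝ)) ≤ dssMu ε₀ T := by
  have hb : 0 < 1 + ε₀ := by linarith
  have hCₑ : 0 ≤ Cₑ := by
    have h0 := henv 0 0
    have h1 : 0 ≤ Real.exp (2 * (0 : ℝ)) * ‖W 0 0‖ ^ 2 := by positivity
    have h2 : Cₑ * Real.exp (2 * T) ^ (0 : ℤ) = Cₑ := by simp
    rw [h2] at h0
    exact h1.trans h0
  set θ : ℝ := physWeight 1 ε₀ * Real.exp (2 * T) with hθ
  have hpw : physWeight 1 ε₀ = (1 + ε₀) / (1 + ε₀) ^ 5 := by unfold physWeight; rw [Real.rpow_one]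
  have hθ0 : 0 ≤ θ := by rw [hθ, hpw]; positivity
  by_contra hlt
  push Not at hlt
  have hθ1 : θ < 1 := by
    rw [Real.rpow_neg hb.le, Real.rpow_one] at hlt
    have e : θ = (1 + ε₀) * dssMu ε₀ T := by rw [hθ, hpw]; unfold dssMu; ring
    rw [e]
    calc (1 + ε₀) * dssMu ε₀ T < (1 + ε₀) * (1 + ε₀)⁻¹ := mul_lt_mul_of_pos_left hlt hb
      _ = 1 := mul_inv_cancel₀ hb.ne'
  obtain ⟨c, hc, H⟩ := hS
  obtain ⟨K, hK⟩ := exists_pow_lt_of_lt_one (div_pos hc (by linarith : (0 : ℝ) < Cₑ + 1)) hθ1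
  obtain ⟨n, hn, σ, -, hle⟩ := H K
  have h1 : physWeight 1 ε₀ ^ n * (Real.exp (2 * σ) * ‖W n σ‖ ^ 2) ≤ θ ^ n * Cₑ := by
    have h := mul_le_mul_of_nonneg_left (henv n σ) (pow_nonneg (by rw [hpw]; positivity) n :
      0 ≤ physWeight 1 ε₀ ^ n)
    calc physWeight 1 ε₀ ^ n * (Real.exp (2 * σ) * ‖W n σ‖ ^ 2)
        ≤ physWeight 1 ε₀ ^ n * (Cₑ * Real.exp (2 * T) ^ (n : ℤ)) := h
      _ = θ ^ n * Cₑ := by rw [hθ, mul_pow, zpow_natCast]; ring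
  have h2 : θ ^ n ≤ θ ^ K := pow_le_pow_of_le_one hθ0 hθ1.le hn
  have h3 : θ ^ n * Cₑ ≤ θ ^ K * Cₑ := mul_le_mul_of_nonneg_right h2 hCₑ
  have h4 : θ ^ K * Cₑ < c := by
    have h5 : θ ^ K * Cₑ ≤ c / (Cₑ + 1) * Cₑ := mul_le_mul_of_nonneg_right hK.le hCₑ
    have h6 : c / (Cₑ + 1) * Cₑ < c := by
      rw [div_mul_eq_mul_div, div_lt_iff₀ (by linarith : (0 : ℝ) < Cₑ + 1)]
      nlinarith
    linarith
  linarith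

/-- **THE FRONT-FOLLOWING ω-LIMIT OF AN ASYMPTOTICALLY SHIFT-PERIODIC SOLUTION IS SHIFT-PERIODIC.** Let `W` be a
uniformly bounded admissible eternal solution with two-sided envelope `e^{2σ}‖W_n(σ)‖² ≤ Cₑ (e^{2T})^n`, a floor
`δ ≤ ‖W_{jq}(jqT)‖` along the front-following centres `(jq, jqT)`, and ASYMPTOTIC `(q,T)`-PERIODICITY along them:
`W_{n+q+jq}(σ + qT + jqT) - W_{n+jq}(σ + jqT) → 0` (`j → ∞`) for every `n, σ`. Then some subsequential limit `W∞`
of the translates `W_{n+jq}(u + jqT)` is an admissible, uniformly bounded eternal solution that is EXACTLY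
shift-periodic, `W∞_{n+q}(σ) = W∞_n(σ - qT)`, with `δ ≤ ‖W∞_0(0)‖`.
[cite: Tao2016AveragedNS, §4 Lemma 4.1 (iii) (4.8), §6.4; KochNadirashviliSereginSverak2009, Thm 1.1 ff. (compactness shape); cell vocabulary (`IsEternal`, `UniformBound`)] -/
theorem shiftPeriodic_limit_of_asymptoticallyPeriodic {ε₀ T Cₑ δ : ℝ}
    {α : Fin m → Fin m → Fin m → ℤ × ℤ × ℤ → ℝ} {W : ℤ → ℝ → Em m}
    (hW : IsEternal ε₀ α W) {C : ℝ} (hC : ∀ (n : ℤ) (σ : ℝ), ‖W n σ‖ ≤ C) {q : ℕ}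
    (henv : ∀ (n : ℤ) (σ : ℝ), Real.exp (2 * σ) * ‖W n σ‖ ^ 2 ≤ Cₑ * Real.exp (2 * T) ^ n)
    (hfloor : ∀ j : ℕ, δ ≤ ‖W ((j : ℤ) * (q : ℤ)) ((j : ℝ) * (q : ℝ) * T)‖)
    (hasym : ∀ (n : ℤ) (σ : ℝ), Tendsto (fun j : ℕ =>
      W (n + q + (j : ℤ) * (q : ℤ)) (σ + q * T + (j : ℝ) * (q : ℝ) * T)
        - W (n + (j : ℤ) * (q : ℤ)) (σ + (j : ℝ) * (q : ℝ) * T)) atTop (𝓝 0)) :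
    ∃ Wlim : ℤ → ℝ → Em m, IsEternal ε₀ α Wlim ∧ UniformBound Wlim ∧
      (∀ (n : ℤ) (σ : ℝ), Wlim (n + q) σ = Wlim n (σ - q * T)) ∧ δ ≤ ‖Wlim 0 0‖ := by
  have hθ : 0 < Real.exp (2 * T) := Real.exp_pos _
  -- front-following centres keep `θ^{d_j} e^{-2 s_j} = 1`
  have hM' : ∀ j : ℕ, Real.exp (2 * T) ^ ((j : ℤ) * (q : ℤ)) * Real.exp (-(2 * ((j : ℝ) * (q : ℝ) * T))) ≤ 1 := by
    intro j
    have e : Real.exp (2 * T) ^ ((j : ℤ) * (q : ℤ)) * Real.exp (-(2 * ((j : ℝ) * (q : ℝ) * T))) = 1 := by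
      rw [← Real.rpow_intCast, ← Real.exp_mul, ← Real.exp_add]
      push_cast
      ring_nf
      exact Real.exp_zero
    rw [e]
  obtain ⟨φ, hφ, Wlim, hconv, hEt, hU, -, -, hfl⟩ :=
    admissibleEternalLimit_of_envelope hW hC hθ henv (fun j => (j : ℤ) * (q : ℤ))
      (fun j => (j : ℝ) * (q : ℝ) * T) hM'
  refine ⟨Wlim, hEt, hU, fun n σ => ?_, hfl δ hfloor⟩
  -- exact periodicity of the limit from asymptotic periodicity along the (sub)sequence of centres
  have h1 : Tendsto (fun j => W (n + q + (φ j : ℤ) * (q : ℤ)) (σ + (φ j : ℝ) * (q : ℝ) * T)) atTop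
      (𝓝 (Wlim (n + q) σ)) := by
    have h := hconv (n + q) (fun _ => σ) σ tendsto_const_nhds
    exact h
  have h2 : Tendsto (fun j => W (n + (φ j : ℤ) * (q : ℤ)) (σ - q * T + (φ j : ℝ) * (q : ℝ) * T)) atTop
      (𝓝 (Wlim n (σ - q * T))) := hconv n (fun _ => σ - q * T) (σ - q * T) tendsto_const_nhds
  have h3 : Tendsto (fun j => W (n + q + (φ j : ℤ) * (q : ℤ)) (σ + (φ j : ℝ) * (q : ℝ) * T)
      - W (n + (φ j : ℤ) * (q : ℤ)) (σ - q * T + (φ j : ℝ) * (q : ℝ) * T)) atTop (𝓝 0) := by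
    have h := (hasym n (σ - q * T)).comp hφ.tendsto_atTop
    have e : ∀ j, σ - q * T + q * T + (φ j : ℝ) * (q : ℝ) * T = σ + (φ j : ℝ) * (q : ℝ) * T := fun j => by ring
    refine h.congr fun j => ?_
    simp only [Function.comp, e]
  have h4 := h1.sub h2
  have h5 := tendsto_nhds_unique h4 h3
  exact sub_eq_zero.1 h5

/-- **THE CRUX'S CONCLUSION FROM ASYMPTOTIC PERIODICITY («rigidity = convergence to DSS»).** A uniformly bounded
admissible eternal solution of the renormalised lattice of `α` with two-sided envelope of ratio `e^{2T}`
(`T > 0`, sub-unitary `μ = e^{2T}/(1+ε₀)^5 < 1`), a floor `δ > 0` along the front `(jq, jqT)` (`q ≥ 1`),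
asymptotic `(q,T)`-periodicity along it, and forward (S₁)-survival, yields a NON-TRIVIAL (S₁)-SURVIVING
ADMISSIBLE DSS WAVE of `α` (the shift-periodic ω-limit, read profile-wise via `isDSSWave_of_shiftPeriodic`).
[cite: Tao2016AveragedNS, §4 Lemma 4.1 (iii) (4.8)–(4.10), §6.4; KochNadirashviliSereginSverak2009, Thm 1.1 ff.; cell vocabulary (`IsEternal`, `UniformBound`, `EternalSurvivingFwd`, `IsDSSWave`, `Surviving`)] -/
theorem survivingDSSWave_of_asymptoticallyPeriodic {ε₀ T Cₑ δ : ℝ} (hε : 0 < ε₀)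
    {α : Fin m → Fin m → Fin m → ℤ × ℤ × ℤ → ℝ} {W : ℤ → ℝ → Em m}
    (hW : IsEternal ε₀ α W) {C : ℝ} (hC : ∀ (n : ℤ) (σ : ℝ), ‖W n σ‖ ≤ C) {q : ℕ} (hq : 0 < q)
    (hT : 0 < T) (hμ : dssMu ε₀ T < 1)
    (henv : ∀ (n : ℤ) (σ : ℝ), Real.exp (2 * σ) * ‖W n σ‖ ^ 2 ≤ Cₑ * Real.exp (2 * T) ^ n)
    (hδ : 0 < δ) (hfloor : ∀ j : ℕ, δ ≤ ‖W ((j : ℤ) * (q : ℤ)) ((j : ℝ) * (q : ℝ) * T)‖)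
    (hasym : ∀ (n : ℤ) (σ : ℝ), Tendsto (fun j : ℕ =>
      W (n + q + (j : ℤ) * (q : ℤ)) (σ + q * T + (j : ℝ) * (q : ℝ) * T)
        - W (n + (j : ℤ) * (q : ℤ)) (σ + (j : ℝ) * (q : ℝ) * T)) atTop (𝓝 0))
    (hS : EternalSurvivingFwd 1 ε₀ W) :
    ∃ (q : ℕ) (π : Equiv.Perm (Fin q)) (T : ℝ) (Φ : Fin q → ℝ → Em m),
      IsDSSWave ε₀ α π T Φ ∧ Surviving 1 ε₀ T ∧ ∃ r x, Φ r x ≠ 0 := by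
  obtain ⟨Wlim, hEt, -, hper, hfl⟩ := shiftPeriodic_limit_of_asymptoticallyPeriodic hW hC henv hfloor hasym
  have hlow := inv_le_dssMu_of_envelope hε henv hS
  obtain ⟨p, rfl⟩ := Nat.exists_eq_succ_of_ne_zero hq.ne'
  have hne : Wlim ((0 : ℕ) : ℤ) 0 ≠ 0 := by
    rw [Nat.cast_zero]
    intro h0
    rw [h0, norm_zero] at hfl
    linarith
  exact ⟨p + 1, finRotate (p + 1), T, fun r x => Wlim (r.val : ℤ) (x + (r.val : ℝ) * T),
    isDSSWave_of_shiftPeriodic hEt hT hper, ⟨hlow, hμ⟩, profile_ne_zero_of_shiftPeriodic hper hne⟩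

/-- **THE REGISTERED STUB `stub_eternalIsDSS` (skeleton `9d85f4d387c689cd` of item 20206) MODULO ASYMPTOTIC
PERIODICITY.** If below a threshold `ε_s(R)` every table `α ∈ E₂(R)` carrying a forward-(S₁)-surviving admissible
eternal solution carries one (`W'`) that is uniformly bounded, has a two-sided envelope of some ratio `e^{2T}`
(`T > 0`, `e^{2T} < (1+ε₀)^5`), a positive floor along a front `(jq, jqT)` (`q ≥ 1`), is ASYMPTOTICALLY
`(q,T)`-PERIODIC along that front and forward (S₁)-surviving, then the signature of `stub_eternalIsDSS` holds
verbatim. («Surviving eternal solutions of the renormalised lattice converge to a DSS wave along their front.»)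
[cite: Tao2016AveragedNS, §4 Thm. 4.2 (statement shape), Lemma 4.1 (4.8), §6.4; cell vocabulary (`InTableClass`, `IsEternal`, `UniformBound`, `EternalSurvivingFwd`, `IsDSSWave`, `Surviving`, `dssMu`)] -/
theorem stub_eternalIsDSS_of_asymptoticPeriodicity
    (H : ∀ R : ℝ, 1 ≤ R → ∃ εs : ℝ, 0 < εs ∧ ∀ ε₀ : ℝ, 0 < ε₀ → ε₀ ≤ εs →
      ∀ α : (Fin 4 → Fin 4 → Fin 4 → ℤ × ℤ × ℤ → ℝ), InTableClass R α →
        (∃ W : ℤ → ℝ → Em 4, IsEternal ε₀ α W ∧ EternalSurvivingFwd 1 ε₀ W) →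
        ∃ (W : ℤ → ℝ → Em 4) (C T Cₑ δ : ℝ) (q : ℕ), IsEternal ε₀ α W ∧
          (∀ (n : ℤ) (σ : ℝ), ‖W n σ‖ ≤ C) ∧ 0 < q ∧ 0 < T ∧ dssMu ε₀ T < 1 ∧
          (∀ (n : ℤ) (σ : ℝ), Real.exp (2 * σ) * ‖W n σ‖ ^ 2 ≤ Cₑ * Real.exp (2 * T) ^ n) ∧
          0 < δ ∧ (∀ j : ℕ, δ ≤ ‖W ((j : ℤ) * (q : ℤ)) ((j : ℝ) * (q : ℝ) * T)‖) ∧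
          (∀ (n : ℤ) (σ : ℝ), Tendsto (fun j : ℕ =>
            W (n + q + (j : ℤ) * (q : ℤ)) (σ + q * T + (j : ℝ) * (q : ℝ) * T)
              - W (n + (j : ℤ) * (q : ℤ)) (σ + (j : ℝ) * (q : ℝ) * T)) atTop (𝓝 0)) ∧
          EternalSurvivingFwd 1 ε₀ W) :
    ∀ R : ℝ, 1 ≤ R → ∃ εs : ℝ, 0 < εs ∧ ∀ ε₀ : ℝ, 0 < ε₀ → ε₀ ≤ εs →
      ∀ α : (Fin 4 → Fin 4 → Fin 4 → ℤ × ℤ × ℤ → ℝ),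
        Literature.Analysis.FluidPDE.TaoCascade.InTableClass R α →
        (∃ W : ℤ → ℝ → Literature.Analysis.FluidPDE.TaoCascade.Em 4,
          Literature.Analysis.FluidPDE.TaoCascade.IsEternal ε₀ α W ∧
          Literature.Analysis.FluidPDE.TaoCascade.EternalSurvivingFwd 1 ε₀ W) →
        ∃ (q : ℕ) (π : Equiv.Perm (Fin q)) (T : ℝ)
          (Φ : Fin q → ℝ → Literature.Analysis.FluidPDE.TaoCascade.Em 4),
          Literature.Analysis.FluidPDE.TaoCascade.IsDSSWave ε₀ α π T Φ ∧
          Literature.Analysis.FluidPDE.TaoCascade.Surviving 1 ε₀ T ∧ ∃ r x, Φ r x ≠ 0 := by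
  intro R hR
  obtain ⟨εs, hεs, hH⟩ := H R hR
  refine ⟨εs, hεs, fun ε₀ hε hεle α hα hex => ?_⟩
  obtain ⟨W, C, T, Cₑ, δ, q, hW, hC, hq, hT, hμ, henv, hδ, hfloor, hasym, hS⟩ := hH ε₀ hε hεle α hα hex
  exact survivingDSSWave_of_asymptoticallyPeriodic hε hW hC hq hT hμ henv hδ hfloor hasym hS

end BlowupRigidityOne

end Summit.NavierStokesRegularity.NavierStokesRegularity.Theorems

end
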